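import Literature.AnabelianGeometry.EtaleTheta.SettingModelChiKummerData
import Literature.AnabelianGeometry.EtaleTheta.SettingModelTateSemidirect
import HarnessLib

/-!
# The `y`-coordinate under the STAGE-2 (Tate-sheared) Galois action — prep for `KummerData.modelχq` (R78 F6q)

Mochizuki, *The étale theta function …*, Publ. RIMS **45** (2009) [EtTh], §1, Prop. 1.5, PRIMS PDF p. 23
[cite: MochizukiEtTh2009, Prop 1.5 p.23]: `log(U) ∈ H¹(Π^tp_Y, Δ_Θ)` — a class on `Π^tp_Y`, not on `Π^tp_X`.

PROOF-ONLY prep (abc-iut cell, R78 stage 2 «Tate shear», row F6q mapped to abc-iut-w5-d171 by the integrator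
abc-iut-L6-d6, R78-MAP #9): under the three-parameter affine action `affTwist₃ ⟨(m,k),α⟩ = Inn(b^m) ∘ shear_k ∘ θ_α`
(abc-iut-L2-t6, `SettingModelChiShearInner`) the `b`-exponent `ê_b` (the `y`-coordinate of the theta quotient,
abc-iut-w5-d029's `eHatB`) is NO LONGER χ-equivariant on all of `F̂₂` — the shear adds `k · ê(x)` — but it IS on
`Ker ê`, which is where the `Γ`-components of `Π^tp_Y = Ker(Π^tp_X ↠ ℤ)` live.  Hence the `y`-coordinate crossed
homomorphism of `SettingModelChiKummerData` (F6 (c)) survives at stage 2 as a cocycle on `(Π^tp_Y)^Θ`: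

* `eHatB_innB` — `ê_b(Inn(b^m) x) = ê_b(x)`;
* `eHatB_shear_of_eHat_eq_one` — `ê(x) = 0 ⇒ ê_b(shear_k x) = ê_b(x)` (from abc-iut-L2-t6's level statement
  `hHat_shear_of_eHat_eq_one` and `hHat_y_eq_modN_eHatB`);
* **`eHatB_affTwist₃_of_eHat_eq_one`** — `ê(x) = 0 ⇒ ê_b(affTwist₃ g x) = g.right (ê_b x)`;
* **`eHatB_actHatχq_of_eHat_eq_one`** — the same for the stage-2 Galois action `actHatχq p i j σ` of
  `SettingModelTateSemidirect`: `ê(x) = 0 ⇒ ê_b(σ · x) = χ(σ) (ê_b x)`.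

Nothing of [EtTh] asserted; semi-synthetic; no side taken on [IUTchIII] Cor. 3.12.
-/

noncomputable section

namespace Literature.AnabelianGeometry.EtaleTheta.SettingModel

open Literature.AnabelianGeometry.SemiGraphs

/-- `ê_b(Inn(b^m) x) = ê_b(x)` (`Ẑ` is commutative). [cite: MochizukiEtTh2009, Prop 1.5 p.23] -/
theorem eHatB_innB (m : ZH) (x : F₂hatT) : eHatB (innB m x) = eHatB x := by
  rw [innB_apply, map_mul, map_mul, map_inv,
    Literature.AnabelianGeometry.AbsoluteAnabelian.ZHatCompletion.mul_comm (eHatB (bPow m)) (eHatB x),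
    mul_inv_cancel_right]

/-- On `Ker ê` the shear does not move the `b`-exponent: `ê(x) = 0 ⇒ ê_b(shear_k x) = ê_b(x)`.
[cite: MochizukiEtTh2009, Prop 1.5 p.23] -/
theorem eHatB_shear_of_eHat_eq_one (k : ZH) {x : F₂hatT} (hx : eHat x = 1) : eHatB (shear k x) = eHatB x := by
  refine ext_of_modN fun N => ?_
  rw [← hHat_y_eq_modN_eHatB, ← hHat_y_eq_modN_eHatB, hHat_shear_of_eHat_eq_one N k hx]

/-- **`ê(x) = 0 ⇒ ê_b(affTwist₃ ⟨(m,k),α⟩ x) = α (ê_b x)`**: on `Ker ê` the three-parameter affine action moves the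
`y`-coordinate through the cyclotomic part only. [cite: MochizukiEtTh2009, Prop 1.5 p.23] -/
theorem eHatB_affTwist₃_of_eHat_eq_one (g : (ZH × ZH) ⋊[diagAut] MulAut ZH) {x : F₂hatT} (hx : eHat x = 1) :
    eHatB (affTwist₃ g x) = g.right (eHatB x) := by
  rw [affTwist₃_apply, eHatB_innB, eHatB_shear_of_eHat_eq_one _ (by rw [eHat_twist, hx]), eHatB_twist]

variable (p : ℕ) [Fact p.Prime] (i j : ℤ)

/-- **Stage-2 Galois action on the `y`-coordinate**: for `x ∈ Ker ê`, `ê_b(σ · x) = χ(σ)(ê_b x)` under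
`actHatχq p i j σ = affTwist₃ (tatePairHom σ)` (whose cyclotomic part is `χ σ`). [cite: MochizukiEtTh2009, Prop 1.5 p.23] -/
theorem eHatB_actHatχq_of_eHat_eq_one (σ : GQp p) {x : F₂hatT} (hx : eHat x = 1) :
    eHatB (actHatχq p i j σ x) = (tatePairHom p i j σ).right (eHatB x) :=
  eHatB_affTwist₃_of_eHat_eq_one _ hx

/-- The `Γ`-component of an element of `Ker(Γ ↠ ℤ)` lies in `Ker ê`. [cite: MochizukiEtTh2009, §1 p.13] -/
theorem eHat_gfpFst_eq_one_of_gfpSnd {γ : Gfp} (hγ : gfpSnd γ = 1) : eHat (gfpFst γ) = 1 := by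
  have h := (mem_Gfp _).mp γ.2
  rw [show (γ : F₂hatT × Multiplicative ℤ).2 = 1 from hγ, map_one] at h
  exact h

end Literature.AnabelianGeometry.EtaleTheta.SettingModel

end
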